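import Summits.QuantumFields.YangMills.Theorems.UnitScaleTiltProp7CovLinAvgPureGauge
import HarnessLib

/-!
# S2β · (D2) FIRST HALF — THE ONE-STEP STRUCTURE OF `Q₁^{R₀}(V)` IN SUP NORM: «MAIN LINE TERM + COARSE COVARIANT GRADIENT OF THE STAIR MEAN + `O(α)`», AND COVARIANT
# GRADIENTS MAP TO COVARIANT GRADIENTS: `Q₁^{R₀}(V)(D_VΦ) = D_{Ū(V)}(Φ∘emb) + O(α‖Φ‖)` (over ✓`Prop7CovLinAvgStructureStep` and ✓`Prop7CovLinAvgPureGauge`, BY NAME)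

Cell `ym3-torus` (YM ladder rung R3 = continuum `SU(2)` Yang–Mills on the three-torus at fixed lattice data — a RUNG: NOT d = 4, NOT infinite volume, NOT a mass gap,
NOT Clay).  Width seat `ym3-torus-px13` (gen 25); crux `stmt-QuantumFields-20520`, LINE g18-1 S2β; letter MULT♮ ⟸ (RINV-curl) ∧ BKG (✓p824141); (RINV-curl) via px16 g21's
«preimages by gauge-family face spreads» (bus 13:44:05Z) needs ONE analytic brick, (D2) «`‖(DΨ_k X)(B)‖ ≤ A·L^k·‖X‖_∞`, `A` independent of `k`», which by (D0) ✓p824574 and (D1)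
✓p824693 reduces to a bootstrap over the structure of the lit covariant linearised average `Q₁^{R₀}(V) = covLinAvgR0 V` ([Balaban1985Averaging] Prop. 3 (124)–(125)).  THIS FILE is
that structure in the currency the bootstrap consumes — `--kind proof --supports stmt-QuantumFields-20520 --as helper`, count-neutral, DEFINITION-FREE (0 `def`, 0 `instance`,
0 `notation`, 0 `sorry`); generic `P : Params`, `SU(n)`, level `j`; matrix-valued bond∕site fields throughout (no `𝔰𝔲`-membership bookkeeping).

NOTATION (written out in every statement; `V : GaugeField P j SU(n)` the background, `Y : PBond P j → M_n(ℂ)`, `Φ : Site P j → M_n(ℂ)`, `I = Idx P`, `A_i, B_i, C_i` the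
holonomies of the source staircase `Γ^{σ_i}_{y→x_i}`, the straight segment `[x_i, x_i′]`, the target staircase `Γ^{σ′_i}_{y′→x_i′}` (lit `loopHol_eq`: `W_i = A_iB_iC_i⁻¹·a⁻¹`,
`a = axialAvg V c`), `Ū(c) = avgFun expMeanLogSU V c = corr·a`):
  `SM_V(Y)(y) := |I|⁻¹ Σ_i Y_V(walk (emb y) (stairWord σ_i (off r_i)))` (the COVARIANT STAIR MEAN — a SITE function),
  `LM_V(Y)(c) := |I|⁻¹ Σ_i A_i·Y_V([x_i,x_i′])·A_i*` (the comb-transported LINE MEAN),  `D_VΦ(b) := Φ(b₋) − V_b·Φ(b₊)·V_b*` (the COVARIANT GRADIENT).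

WHAT IS PROVED (sorry-free).
* §1 `telescope_three` (free ring identity), `norm_covWalkSum_le_length_mul` (the `σ ↔ σ′` symmetry of `Idx` — the target-stair mean IS `SM_V(Y)` at the target site — is lit ✓`sum_idx_swap`),
  `norm_stairMean_le` (`≤ (d+2)L·‖Y‖`), `norm_lineMean_le` (`≤ L·‖Y‖`), `norm_covGrad_le` (`‖D_VΦ b‖ ≤ 2‖Φ‖`).
* §2 ★★`norm_covLinAvgR0_sub_structure_avgFun_le` — (s2′): **`‖Q₁^{R₀}(V)Y(c) − (LM_V(Y)(c) + SM_V(Y)(c₋) − Ū(c)·SM_V(Y)(c₊)·Ū(c)*)‖ ≤ 6·α·(d+2)L·‖Y‖`** when every loop variable of `V`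
  at `c` is within `α` of `1`, `α ≤ 1∕6`, `α < δ_n` (✓`norm_covLinAvgR0_sub_structure_le` + the symmetry + `a ↦ Ū(c)` at cost `2·dist1(corr) ≤ 4α`, lit ✓`dist1_corr_le_two_mul`).
* §3 ★★`covLinAvgR0_covGrad_eq` — EXACT: **`Q₁^{R₀}(V)(D_VΦ)(c) = Φ(emb c₋) − |I|⁻¹Σ_i T_i·Φ(emb c₊)·T_i*`**, `T_i = A_iB_iC_i⁻¹` (three telescoped segments, ✓`covWalkSum_pureGauge_walk`);
  ★★`norm_covLinAvgR0_covGrad_sub_le` — (s1′): **`‖Q₁^{R₀}(V)(D_VΦ)(c) − (Φ(emb c₋) − Ū(c)·Φ(emb c₊)·Ū(c)*)‖ ≤ 6·α·‖Φ(emb c₊)‖`** (`T_i = W_i·corr⁻¹·Ū(c)`).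

HONEST.  Lattice algebra and triangle inequalities over landed theorems; nothing of Bałaban's analysis; (D2)'s bootstrap is the sequel `…ChartReadDerivKStepSup`; (RINV-curl), RINV-cov,
MULT♮, AVG₂♭, «CRIT-ax», (D-ax), GAP♯∘ (registry UNTOUCHED), the five REGISTERED stubs, S2β, crux 20520, 19936, 19200 and `YM3TorusSU2` are NOT proved; no summit statement is
proved by a helper; rung R3 = SU(2) YM₃ on T³ — NOT d = 4, NOT infinite volume, NOT a mass gap, NOT Clay; the Yang–Mills mass gap is NOT proved.  Axioms standard.

References: T. Bałaban, CMP **98** (1985) 17–51 [Balaban1985Averaging] ((56)–(58) p.27, (62)–(63) p.28, Prop. 3 (124)–(126) p.36, (139)–(147) pp.39–40); CMP **95** (1984) 17–40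
[Balaban1984PropagatorsI] ((1.20) p.20); CMP **109** (1987) 249–301 [Balaban1987RG1] ((0.3)–(0.4) pp.252–253).
-/

set_option autoImplicit false

noncomputable section

open scoped BigOperators Matrix.Norms.L2Operator

namespace Summit.QuantumFields.YangMills.Theorems.FluctuationComparisonRegPrIntLS2BetaChartReadDerivStructure

open Literature.MathematicalPhysics.QuantumFieldTheory.Balaban1983to89
open T4Continuum BlockAveraging AveragingRT ExpMeanLog BlockAveragingEMLLinearised BlockAveragingEMLLinearisedBackground BlockAveragingEMLProp2
open Summit.QuantumFields.YangMills.Theorems.Prop7HolRatioPerStep (norm_coe_eq_one norm_star_coe_eq_one coe_star_mul_self coe_mul_star_self norm_mean_le')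
open Summit.QuantumFields.YangMills.Theorems.Prop7CovLinAvgStructureStep (norm_conj_mul_sub_conj_le norm_covLinAvgR0_sub_structure_le covLinAvgR0_eq_three_means)
open Summit.QuantumFields.YangMills.Theorems.Prop7CovLinAvgPureGauge (covWalkSum_pureGauge_walk)

variable {P : Params} {n : Type*} [Fintype n] [DecidableEq n] [Nonempty n] {j : ℕ}

/-! ## §1 Algebra, the `σ ↔ σ′` symmetry, and sup-norm bounds of the stair and line means -/

section Letters

omit [Fintype n] [DecidableEq n] [Nonempty n] in
/-- The three telescoped segments collapse: `(ξy − AξxA*) + A(ξx − Bξx′B*)A* − (ABC*)(ξy′ − Cξx′C*)(CB*A*) = ξy − (ABC*)ξy′(CB*A*)` given `C*C = 1`. [folklore] -/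
theorem telescope_three {R : Type*} [Ring R] (ξy ξx ξx' ξy' A As B Bs C Cs : R) (hC : Cs * C = 1) :
    (ξy - A * ξx * As) + A * (ξx - B * ξx' * Bs) * As - (A * B * Cs) * (ξy' - C * ξx' * Cs) * (C * Bs * As) =
      ξy - (A * B * Cs) * ξy' * (C * Bs * As) := by
  have e1 : (A * B * Cs) * (ξy' - C * ξx' * Cs) * (C * Bs * As) =
      A * B * Cs * ξy' * (C * Bs * As) - A * B * (Cs * C) * ξx' * (Cs * C) * Bs * As := by noncomm_ring
  rw [e1, hC]
  noncomm_ring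

/-- `‖Y_V(γ)‖ ≤ |γ|·‖Y‖` (sup norm; transports are isometries). [cite: Balaban1985Averaging, (58) p.27] -/
theorem norm_covWalkSum_le_length_mul (U₀ : GaugeField P j (Matrix.specialUnitaryGroup n ℂ)) (Y : PBond P j → Matrix n n ℂ) (γ : List (LStep P j)) :
    ‖covWalkSum U₀ Y γ‖ ≤ (γ.length : ℝ) * ‖Y‖ :=
  norm_covWalkSum_le U₀ (fun b => norm_le_pi_norm Y b) γ

/-- **THE STAIR MEAN IS `≤ (d+2)L·‖Y‖`** (each staircase has at most `(d+2)L` steps). [cite: Balaban1987RG1, (0.3) p.252; Balaban1985Averaging, (126) p.36] -/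
theorem norm_stairMean_le (U₀ : GaugeField P j (Matrix.specialUnitaryGroup n ℂ)) (Y : PBond P j → Matrix n n ℂ) (y : Site P (j + 1)) :
    ‖((Fintype.card (Idx P) : ℂ))⁻¹ • ∑ i : Idx P, covWalkSum U₀ Y (walk (emb y) (stairWord i.2.1 (off i.1)))‖ ≤ (((P.d + 2) * P.L : ℕ) : ℝ) * ‖Y‖ := by
  refine norm_mean_le' fun i => ?_
  refine (norm_covWalkSum_le_length_mul U₀ Y _).trans (mul_le_mul_of_nonneg_right ?_ (norm_nonneg _))
  exact_mod_cast length_walk_stairWord_le (emb y) i.2.1 i.1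

/-- **THE TRANSPORTED LINE MEAN IS `≤ L·‖Y‖`** (the segment has exactly `L` steps; conjugation by `A_i` is an isometry). [cite: Balaban1987RG1, (0.4) p.253; Balaban1985Averaging, (126) p.36] -/
theorem norm_lineMean_le (U₀ : GaugeField P j (Matrix.specialUnitaryGroup n ℂ)) (Y : PBond P j → Matrix n n ℂ) (c : PBond P (j + 1)) :
    ‖((Fintype.card (Idx P) : ℂ))⁻¹ • ∑ i : Idx P,
        ((holAt U₀ (walk (emb c.src) (stairWord i.2.1 (off i.1))) : Matrix.specialUnitaryGroup n ℂ) : Matrix n n ℂ) *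
          covWalkSum U₀ Y (walk (walkEnd (emb c.src) (stairWord i.2.1 (off i.1))) (List.replicate P.L (c.dir, true))) *
        star ((holAt U₀ (walk (emb c.src) (stairWord i.2.1 (off i.1))) : Matrix.specialUnitaryGroup n ℂ) : Matrix n n ℂ)‖ ≤ (P.L : ℝ) * ‖Y‖ := by
  refine norm_mean_le' fun i => ?_
  have hconj : ∀ (g : Matrix.specialUnitaryGroup n ℂ) (X : Matrix n n ℂ), ‖(g : Matrix n n ℂ) * X * star (g : Matrix n n ℂ)‖ ≤ ‖X‖ := by
    intro g X
    calc _ ≤ ‖(g : Matrix n n ℂ)‖ * ‖X‖ * ‖star (g : Matrix n n ℂ)‖ :=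
          (norm_mul_le _ _).trans (mul_le_mul_of_nonneg_right (norm_mul_le _ _) (norm_nonneg _))
      _ = ‖X‖ := by rw [norm_coe_eq_one, norm_star_coe_eq_one, one_mul, mul_one]
  refine (hconj _ _).trans ((norm_covWalkSum_le_length_mul U₀ Y _).trans (le_of_eq ?_))
  rw [length_walk, List.length_replicate]

/-- The covariant gradient of a site function is bond-wise `≤ 2·‖Φ‖`. [cite: Balaban1985Averaging, (62) p.28 (bookkeeping)] -/
theorem norm_covGrad_le (U₀ : GaugeField P j (Matrix.specialUnitaryGroup n ℂ)) (Φ : Site P j → Matrix n n ℂ) (b : PBond P j) :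
    ‖Φ b.src - ((U₀ b : Matrix.specialUnitaryGroup n ℂ) : Matrix n n ℂ) * Φ b.tgt * star ((U₀ b : Matrix.specialUnitaryGroup n ℂ) : Matrix n n ℂ)‖ ≤ 2 * ‖Φ‖ := by
  have h1 : ‖Φ b.src‖ ≤ ‖Φ‖ := norm_le_pi_norm Φ b.src
  have h2 : ‖((U₀ b : Matrix.specialUnitaryGroup n ℂ) : Matrix n n ℂ) * Φ b.tgt * star ((U₀ b : Matrix.specialUnitaryGroup n ℂ) : Matrix n n ℂ)‖ ≤ ‖Φ‖ := by
    calc _ ≤ ‖((U₀ b : Matrix.specialUnitaryGroup n ℂ) : Matrix n n ℂ)‖ * ‖Φ b.tgt‖ * ‖star ((U₀ b : Matrix.specialUnitaryGroup n ℂ) : Matrix n n ℂ)‖ :=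
          (norm_mul_le _ _).trans (mul_le_mul_of_nonneg_right (norm_mul_le _ _) (norm_nonneg _))
      _ = ‖Φ b.tgt‖ := by rw [norm_coe_eq_one, norm_star_coe_eq_one, one_mul, mul_one]
      _ ≤ ‖Φ‖ := norm_le_pi_norm Φ b.tgt
  calc _ ≤ ‖Φ b.src‖ + ‖((U₀ b : Matrix.specialUnitaryGroup n ℂ) : Matrix n n ℂ) * Φ b.tgt * star ((U₀ b : Matrix.specialUnitaryGroup n ℂ) : Matrix n n ℂ)‖ := norm_sub_le _ _
    _ ≤ 2 * ‖Φ‖ := by linarith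

/-- `Ū(c) = corr·a` with `dist1(corr) ≤ 2α`: replacing the straight coarse bond `a = axialAvg V c` by the averaged one in a conjugation costs `4α·‖X‖`.
[cite: Balaban1985Averaging, Prop. 2 (52) p.26; Balaban1987RG1, (0.4) p.253] -/
theorem norm_conj_avgFun_sub_conj_axialAvg_le (U₀ : GaugeField P j (Matrix.specialUnitaryGroup n ℂ)) (c : PBond P (j + 1)) {α : ℝ}
    (hα : ∀ i : Idx P, dist1 (loopHol U₀ c i) ≤ α) (hαδ : α < deltaSU n) (hα6 : α ≤ 1 / 6) (X : Matrix n n ℂ) :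
    ‖((avgFun (expMeanLogSU (n := n)) U₀ c : Matrix.specialUnitaryGroup n ℂ) : Matrix n n ℂ) * X *
          star ((avgFun (expMeanLogSU (n := n)) U₀ c : Matrix.specialUnitaryGroup n ℂ) : Matrix n n ℂ) -
        ((axialAvg U₀ c : Matrix.specialUnitaryGroup n ℂ) : Matrix n n ℂ) * X * star ((axialAvg U₀ c : Matrix.specialUnitaryGroup n ℂ) : Matrix n n ℂ)‖ ≤
      4 * α * ‖X‖ := by
  have hfac : avgFun (expMeanLogSU (n := n)) U₀ c = corr (expMeanLogSU (n := n)) U₀ c * axialAvg U₀ c := rfl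
  rw [hfac]
  have h1 := norm_conj_mul_sub_conj_le (corr (expMeanLogSU (n := n)) U₀ c) (axialAvg U₀ c) X
  have hcorr : ‖((corr (expMeanLogSU (n := n)) U₀ c : Matrix.specialUnitaryGroup n ℂ) : Matrix n n ℂ) - 1‖ ≤ 2 * α := by
    rw [← FederbushMean.dist1_SU_eq]; exact dist1_corr_le_two_mul U₀ c hα hαδ hα6
  calc _ ≤ 2 * ‖((corr (expMeanLogSU (n := n)) U₀ c : Matrix.specialUnitaryGroup n ℂ) : Matrix n n ℂ) - 1‖ * ‖X‖ := h1
    _ ≤ 2 * (2 * α) * ‖X‖ := by gcongr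
    _ = 4 * α * ‖X‖ := by ring

end Letters

/-! ## §2 (s2′) The one-step structure with the AVERAGED coarse bond -/

section Structure

/-- ★★ **(s2′) THE ONE-STEP STRUCTURE OF `Q₁^{R₀}(V)` IN SUP NORM**: line mean + (stair mean at `c₋`) − `Ū(c)`·(stair mean at `c₊`)·`Ū(c)*`, up to `6α(d+2)L‖Y‖` — i.e.
`Q₁^{R₀}(V)Y = LM_V(Y) + D_{Ū(V)}(SM_V(Y)) + e`, `‖e(c)‖ ≤ 6α(d+2)L‖Y‖`. [cite: Balaban1985Averaging, Prop. 3 (124)-(126) p.36, (62)-(63) p.28] -/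
theorem norm_covLinAvgR0_sub_structure_avgFun_le (U₀ : GaugeField P j (Matrix.specialUnitaryGroup n ℂ)) (Y : PBond P j → Matrix n n ℂ) (c : PBond P (j + 1))
    {α : ℝ} (hα : ∀ i : Idx P, dist1 (loopHol U₀ c i) ≤ α) (hαδ : α < deltaSU n) (hα6 : α ≤ 1 / 6) :
    ‖covLinAvgR0 U₀ Y c
        - (((Fintype.card (Idx P) : ℂ))⁻¹ • ∑ i : Idx P,
              ((holAt U₀ (walk (emb c.src) (stairWord i.2.1 (off i.1))) : Matrix.specialUnitaryGroup n ℂ) : Matrix n n ℂ) *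
                covWalkSum U₀ Y (walk (walkEnd (emb c.src) (stairWord i.2.1 (off i.1))) (List.replicate P.L (c.dir, true))) *
              star ((holAt U₀ (walk (emb c.src) (stairWord i.2.1 (off i.1))) : Matrix.specialUnitaryGroup n ℂ) : Matrix n n ℂ)
          + ((Fintype.card (Idx P) : ℂ))⁻¹ • ∑ i : Idx P, covWalkSum U₀ Y (walk (emb c.src) (stairWord i.2.1 (off i.1)))
          - ((avgFun (expMeanLogSU (n := n)) U₀ c : Matrix.specialUnitaryGroup n ℂ) : Matrix n n ℂ) *
              (((Fintype.card (Idx P) : ℂ))⁻¹ • ∑ i : Idx P, covWalkSum U₀ Y (walk (emb c.tgt) (stairWord i.2.1 (off i.1)))) *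
            star ((avgFun (expMeanLogSU (n := n)) U₀ c : Matrix.specialUnitaryGroup n ℂ) : Matrix n n ℂ))‖
      ≤ 6 * α * ((((P.d + 2) * P.L : ℕ) : ℝ) * ‖Y‖) := by
  classical
  have hI : (0 : ℝ) < (Fintype.card (Idx P) : ℝ) := by exact_mod_cast Fintype.card_pos
  have hα0 : 0 ≤ α := (GaugeGroup.dist1_nonneg _).trans (hα (Classical.arbitrary (Idx P)))
  -- abbreviations
  set LM : Matrix n n ℂ := ((Fintype.card (Idx P) : ℂ))⁻¹ • ∑ i : Idx P,
      ((holAt U₀ (walk (emb c.src) (stairWord i.2.1 (off i.1))) : Matrix.specialUnitaryGroup n ℂ) : Matrix n n ℂ) *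
        covWalkSum U₀ Y (walk (walkEnd (emb c.src) (stairWord i.2.1 (off i.1))) (List.replicate P.L (c.dir, true))) *
      star ((holAt U₀ (walk (emb c.src) (stairWord i.2.1 (off i.1))) : Matrix.specialUnitaryGroup n ℂ) : Matrix n n ℂ) with hLM
  set CM : Matrix n n ℂ := ((Fintype.card (Idx P) : ℂ))⁻¹ • ∑ i : Idx P, covWalkSum U₀ Y (walk (emb c.src) (stairWord i.2.1 (off i.1))) with hCM
  set CM' : Matrix n n ℂ := ((Fintype.card (Idx P) : ℂ))⁻¹ • ∑ i : Idx P, covWalkSum U₀ Y (walk (emb c.tgt) (stairWord i.2.2 (off i.1))) with hCM'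
  set SMt : Matrix n n ℂ := ((Fintype.card (Idx P) : ℂ))⁻¹ • ∑ i : Idx P, covWalkSum U₀ Y (walk (emb c.tgt) (stairWord i.2.1 (off i.1))) with hSMt
  set a : Matrix n n ℂ := ((axialAvg U₀ c : Matrix.specialUnitaryGroup n ℂ) : Matrix n n ℂ) with ha
  set u : Matrix n n ℂ := ((avgFun (expMeanLogSU (n := n)) U₀ c : Matrix.specialUnitaryGroup n ℂ) : Matrix n n ℂ) with hu
  -- the `σ ↔ σ′` symmetry: the target-comb mean IS the stair mean at the target site
  have hsym : CM' = SMt := by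
    rw [hCM', hSMt]
    congr 1
    exact sum_idx_swap (fun r σ => covWalkSum U₀ Y (walk (emb c.tgt) (stairWord σ (off r))))
  -- the structure lemma (straight coarse bond `a`)
  have hstruct := norm_covLinAvgR0_sub_structure_le U₀ Y c hα
  -- its defect in sup norm
  have hmass : ((Fintype.card (Idx P) : ℝ))⁻¹ * ∑ i : Idx P, ((walk (emb c.tgt) (stairWord i.2.2 (off i.1))).map fun s => ‖Y s.bond‖).sum ≤
      (((P.d + 2) * P.L : ℕ) : ℝ) * ‖Y‖ := by
    have hpt : ∀ i : Idx P, ((walk (emb c.tgt) (stairWord i.2.2 (off i.1))).map fun s => ‖Y s.bond‖).sum ≤ (((P.d + 2) * P.L : ℕ) : ℝ) * ‖Y‖ := by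
      intro i
      have hlen := length_walk_stairWord_le (P := P) (emb c.tgt) i.2.2 i.1
      have hsum : ∀ γ : List (LStep P j), (γ.map fun s => ‖Y s.bond‖).sum ≤ (γ.length : ℝ) * ‖Y‖ := by
        intro γ
        induction γ with
        | nil => simp
        | cons s γ ih =>
          simp only [List.map_cons, List.sum_cons, List.length_cons, Nat.cast_succ]
          have := norm_le_pi_norm Y s.bond
          linarith
      refine (hsum _).trans (mul_le_mul_of_nonneg_right ?_ (norm_nonneg _))
      exact_mod_cast hlen
    calc ((Fintype.card (Idx P) : ℝ))⁻¹ * ∑ i : Idx P, ((walk (emb c.tgt) (stairWord i.2.2 (off i.1))).map fun s => ‖Y s.bond‖).sum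
        ≤ ((Fintype.card (Idx P) : ℝ))⁻¹ * ∑ _i : Idx P, (((P.d + 2) * P.L : ℕ) : ℝ) * ‖Y‖ :=
          mul_le_mul_of_nonneg_left (Finset.sum_le_sum fun i _ => hpt i) (by positivity)
      _ = (((P.d + 2) * P.L : ℕ) : ℝ) * ‖Y‖ := by
          rw [Finset.sum_const, Finset.card_univ, nsmul_eq_mul]; field_simp
  have h1 : ‖covLinAvgR0 U₀ Y c - (CM + LM - a * CM' * star a)‖ ≤ 2 * α * ((((P.d + 2) * P.L : ℕ) : ℝ) * ‖Y‖) :=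
    hstruct.trans (mul_le_mul_of_nonneg_left hmass (by positivity))
  -- replace `a` by `Ū(c)`
  have hSMt_le : ‖SMt‖ ≤ (((P.d + 2) * P.L : ℕ) : ℝ) * ‖Y‖ := norm_stairMean_le U₀ Y c.tgt
  have h2 : ‖u * SMt * star u - a * SMt * star a‖ ≤ 4 * α * ((((P.d + 2) * P.L : ℕ) : ℝ) * ‖Y‖) :=
    (norm_conj_avgFun_sub_conj_axialAvg_le U₀ c hα hαδ hα6 SMt).trans (mul_le_mul_of_nonneg_left hSMt_le (by positivity))
  have e : covLinAvgR0 U₀ Y c - (LM + CM - u * SMt * star u) =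
      (covLinAvgR0 U₀ Y c - (CM + LM - a * CM' * star a)) + (u * SMt * star u - a * SMt * star a) := by
    rw [hsym]; abel
  rw [e]
  calc ‖(covLinAvgR0 U₀ Y c - (CM + LM - a * CM' * star a)) + (u * SMt * star u - a * SMt * star a)‖
      ≤ ‖covLinAvgR0 U₀ Y c - (CM + LM - a * CM' * star a)‖ + ‖u * SMt * star u - a * SMt * star a‖ := norm_add_le _ _
    _ ≤ 2 * α * ((((P.d + 2) * P.L : ℕ) : ℝ) * ‖Y‖) + 4 * α * ((((P.d + 2) * P.L : ℕ) : ℝ) * ‖Y‖) := add_le_add h1 h2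
    _ = 6 * α * ((((P.d + 2) * P.L : ℕ) : ℝ) * ‖Y‖) := by ring

end Structure

/-! ## §3 (s1′) Covariant gradients map to coarse covariant gradients -/

section Gradient

omit [Nonempty n] in
/-- Per loop index, the three telescoped pieces collapse to `ξy − T·ξy′·T*`, `T = A·B·C⁻¹`. [cite: Balaban1985Averaging, (58) p.27 (bookkeeping)] -/
theorem threePieces_collapse (A B C : Matrix.specialUnitaryGroup n ℂ) (ξy ξx ξx' ξy' : Matrix n n ℂ) :
    (ξy - (A : Matrix n n ℂ) * ξx * star (A : Matrix n n ℂ)) +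
        (A : Matrix n n ℂ) * (ξx - (B : Matrix n n ℂ) * ξx' * star (B : Matrix n n ℂ)) * star (A : Matrix n n ℂ) -
        ((A * B * C⁻¹ : Matrix.specialUnitaryGroup n ℂ) : Matrix n n ℂ) * (ξy' - (C : Matrix n n ℂ) * ξx' * star (C : Matrix n n ℂ)) *
          star ((A * B * C⁻¹ : Matrix.specialUnitaryGroup n ℂ) : Matrix n n ℂ) =
      ξy - ((A * B * C⁻¹ : Matrix.specialUnitaryGroup n ℂ) : Matrix n n ℂ) * ξy' * star ((A * B * C⁻¹ : Matrix.specialUnitaryGroup n ℂ) : Matrix n n ℂ) := by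
  have hinv : ((C⁻¹ : Matrix.specialUnitaryGroup n ℂ) : Matrix n n ℂ) = star (C : Matrix n n ℂ) := rfl
  rw [Submonoid.coe_mul, Submonoid.coe_mul, hinv, star_mul, star_mul, star_star]
  have h := telescope_three ξy ξx ξx' ξy' (A : Matrix n n ℂ) (star (A : Matrix n n ℂ)) (B : Matrix n n ℂ) (star (B : Matrix n n ℂ))
    (C : Matrix n n ℂ) (star (C : Matrix n n ℂ)) (coe_star_mul_self C)
  simp only [mul_assoc] at h ⊢
  exact h

/-- ★★ **EXACT: `Q₁^{R₀}(V)(D_VΦ)(c) = Φ(emb c₋) − |I|⁻¹Σ_i T_i·Φ(emb c₊)·T_i*`**, `T_i = A_iB_iC_i⁻¹` — each of the three segments telescopes (✓`covWalkSum_pureGauge_walk`) and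
the pieces collapse (`threePieces_collapse`; the target staircase ends where the segment ends, lit `walkEnd_stairWord_replicate`). [cite: Balaban1985Averaging, (58) p.27, (124)-(125) p.36; Balaban1984PropagatorsI, (1.20) p.20] -/
theorem covLinAvgR0_covGrad_eq (U₀ : GaugeField P j (Matrix.specialUnitaryGroup n ℂ)) (Φ : Site P j → Matrix n n ℂ) (c : PBond P (j + 1)) :
    covLinAvgR0 U₀ (fun b : PBond P j => Φ b.src - ((U₀ b : Matrix.specialUnitaryGroup n ℂ) : Matrix n n ℂ) * Φ b.tgt *
        star ((U₀ b : Matrix.specialUnitaryGroup n ℂ) : Matrix n n ℂ)) c =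
      Φ (emb c.src) - ((Fintype.card (Idx P) : ℂ))⁻¹ • ∑ i : Idx P,
        ((holAt U₀ (walk (emb c.src) (stairWord i.2.1 (off i.1))) *
              holAt U₀ (walk (walkEnd (emb c.src) (stairWord i.2.1 (off i.1))) (List.replicate P.L (c.dir, true))) *
              (holAt U₀ (walk (emb c.tgt) (stairWord i.2.2 (off i.1))))⁻¹ : Matrix.specialUnitaryGroup n ℂ) : Matrix n n ℂ) *
          Φ (emb c.tgt) *
        star ((holAt U₀ (walk (emb c.src) (stairWord i.2.1 (off i.1))) *
              holAt U₀ (walk (walkEnd (emb c.src) (stairWord i.2.1 (off i.1))) (List.replicate P.L (c.dir, true))) *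
              (holAt U₀ (walk (emb c.tgt) (stairWord i.2.2 (off i.1))))⁻¹ : Matrix.specialUnitaryGroup n ℂ) : Matrix n n ℂ) := by
  classical
  have hI : (Fintype.card (Idx P) : ℂ) ≠ 0 := by exact_mod_cast Fintype.card_ne_zero
  have hterm : ∀ i : Idx P,
      covWalkSum U₀ (fun b : PBond P j => Φ b.src - ((U₀ b : Matrix.specialUnitaryGroup n ℂ) : Matrix n n ℂ) * Φ b.tgt *
            star ((U₀ b : Matrix.specialUnitaryGroup n ℂ) : Matrix n n ℂ)) (walk (emb c.src) (stairWord i.2.1 (off i.1))) +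
          ((holAt U₀ (walk (emb c.src) (stairWord i.2.1 (off i.1))) : Matrix.specialUnitaryGroup n ℂ) : Matrix n n ℂ) *
              covWalkSum U₀ (fun b : PBond P j => Φ b.src - ((U₀ b : Matrix.specialUnitaryGroup n ℂ) : Matrix n n ℂ) * Φ b.tgt *
                star ((U₀ b : Matrix.specialUnitaryGroup n ℂ) : Matrix n n ℂ))
                (walk (walkEnd (emb c.src) (stairWord i.2.1 (off i.1))) (List.replicate P.L (c.dir, true))) *
            star ((holAt U₀ (walk (emb c.src) (stairWord i.2.1 (off i.1))) : Matrix.specialUnitaryGroup n ℂ) : Matrix n n ℂ) -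
          ((holAt U₀ (walk (emb c.src) (stairWord i.2.1 (off i.1))) *
                holAt U₀ (walk (walkEnd (emb c.src) (stairWord i.2.1 (off i.1))) (List.replicate P.L (c.dir, true))) *
                (holAt U₀ (walk (emb c.tgt) (stairWord i.2.2 (off i.1))))⁻¹ : Matrix.specialUnitaryGroup n ℂ) : Matrix n n ℂ) *
              covWalkSum U₀ (fun b : PBond P j => Φ b.src - ((U₀ b : Matrix.specialUnitaryGroup n ℂ) : Matrix n n ℂ) * Φ b.tgt *
                star ((U₀ b : Matrix.specialUnitaryGroup n ℂ) : Matrix n n ℂ)) (walk (emb c.tgt) (stairWord i.2.2 (off i.1))) *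
            star ((holAt U₀ (walk (emb c.src) (stairWord i.2.1 (off i.1))) *
                holAt U₀ (walk (walkEnd (emb c.src) (stairWord i.2.1 (off i.1))) (List.replicate P.L (c.dir, true))) *
                (holAt U₀ (walk (emb c.tgt) (stairWord i.2.2 (off i.1))))⁻¹ : Matrix.specialUnitaryGroup n ℂ) : Matrix n n ℂ) =
        Φ (emb c.src) -
          ((holAt U₀ (walk (emb c.src) (stairWord i.2.1 (off i.1))) *
                holAt U₀ (walk (walkEnd (emb c.src) (stairWord i.2.1 (off i.1))) (List.replicate P.L (c.dir, true))) *
                (holAt U₀ (walk (emb c.tgt) (stairWord i.2.2 (off i.1))))⁻¹ : Matrix.specialUnitaryGroup n ℂ) : Matrix n n ℂ) *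
            Φ (emb c.tgt) *
          star ((holAt U₀ (walk (emb c.src) (stairWord i.2.1 (off i.1))) *
                holAt U₀ (walk (walkEnd (emb c.src) (stairWord i.2.1 (off i.1))) (List.replicate P.L (c.dir, true))) *
                (holAt U₀ (walk (emb c.tgt) (stairWord i.2.2 (off i.1))))⁻¹ : Matrix.specialUnitaryGroup n ℂ) : Matrix n n ℂ) := by
    intro i
    rw [covWalkSum_pureGauge_walk U₀ Φ (emb c.src) (stairWord i.2.1 (off i.1)),
      covWalkSum_pureGauge_walk U₀ Φ (walkEnd (emb c.src) (stairWord i.2.1 (off i.1))) (List.replicate P.L (c.dir, true)),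
      covWalkSum_pureGauge_walk U₀ Φ (emb c.tgt) (stairWord i.2.2 (off i.1)),
      walkEnd_stairWord_replicate c.src c.dir i.2.1 i.2.2 (off i.1)]
    exact threePieces_collapse _ _ _ _ _ _ _
  unfold covLinAvgR0
  rw [Finset.sum_congr rfl (fun i _ => hterm i), Finset.sum_sub_distrib, Finset.sum_const, Finset.card_univ, smul_sub,
    ← Nat.cast_smul_eq_nsmul ℂ, smul_smul, inv_mul_cancel₀ hI, one_smul]

/-- ★★ **(s1′) COVARIANT GRADIENTS MAP TO COARSE COVARIANT GRADIENTS UP TO `6α`**: if every loop variable of `V` at `c` is within `α` of `1`, `α ≤ 1∕6`, `α < δ_n`, then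
`‖Q₁^{R₀}(V)(D_VΦ)(c) − (Φ(emb c₋) − Ū(c)·Φ(emb c₊)·Ū(c)*)‖ ≤ 6α·‖Φ(emb c₊)‖` (`T_i = W_i·corr⁻¹·Ū(c)`, `dist1(W_i·corr⁻¹) ≤ α + 2α`).
[cite: Balaban1985Averaging, (124) p.36, (62)-(63) p.28; Balaban1984PropagatorsI, (1.20) p.20] -/
theorem norm_covLinAvgR0_covGrad_sub_le (U₀ : GaugeField P j (Matrix.specialUnitaryGroup n ℂ)) (Φ : Site P j → Matrix n n ℂ) (c : PBond P (j + 1))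
    {α : ℝ} (hα : ∀ i : Idx P, dist1 (loopHol U₀ c i) ≤ α) (hαδ : α < deltaSU n) (hα6 : α ≤ 1 / 6) :
    ‖covLinAvgR0 U₀ (fun b : PBond P j => Φ b.src - ((U₀ b : Matrix.specialUnitaryGroup n ℂ) : Matrix n n ℂ) * Φ b.tgt *
          star ((U₀ b : Matrix.specialUnitaryGroup n ℂ) : Matrix n n ℂ)) c -
        (Φ (emb c.src) - ((avgFun (expMeanLogSU (n := n)) U₀ c : Matrix.specialUnitaryGroup n ℂ) : Matrix n n ℂ) * Φ (emb c.tgt) *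
          star ((avgFun (expMeanLogSU (n := n)) U₀ c : Matrix.specialUnitaryGroup n ℂ) : Matrix n n ℂ))‖ ≤ 6 * α * ‖Φ (emb c.tgt)‖ := by
  classical
  have hI : (0 : ℝ) < (Fintype.card (Idx P) : ℝ) := by exact_mod_cast Fintype.card_pos
  have hα0 : 0 ≤ α := (GaugeGroup.dist1_nonneg _).trans (hα (Classical.arbitrary (Idx P)))
  set T : Idx P → Matrix.specialUnitaryGroup n ℂ := fun i =>
    holAt U₀ (walk (emb c.src) (stairWord i.2.1 (off i.1))) *
      holAt U₀ (walk (walkEnd (emb c.src) (stairWord i.2.1 (off i.1))) (List.replicate P.L (c.dir, true))) *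
      (holAt U₀ (walk (emb c.tgt) (stairWord i.2.2 (off i.1))))⁻¹ with hT
  set u : Matrix.specialUnitaryGroup n ℂ := avgFun (expMeanLogSU (n := n)) U₀ c with hu
  -- `T_i = (W_i · corr⁻¹) · Ū(c)`
  have hTW : ∀ i, T i = (loopHol U₀ c i * (corr (expMeanLogSU (n := n)) U₀ c)⁻¹) * u := by
    intro i
    have h1 : T i = loopHol U₀ c i * axialAvg U₀ c := by rw [loopHol_eq, hT, inv_mul_cancel_right]
    have h2 : u = corr (expMeanLogSU (n := n)) U₀ c * axialAvg U₀ c := rfl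
    rw [h1, h2, mul_assoc, inv_mul_cancel_left]
  have hdist : ∀ i, ‖(((loopHol U₀ c i * (corr (expMeanLogSU (n := n)) U₀ c)⁻¹ : Matrix.specialUnitaryGroup n ℂ)) : Matrix n n ℂ) - 1‖ ≤ 3 * α := by
    intro i
    rw [← FederbushMean.dist1_SU_eq]
    calc dist1 (loopHol U₀ c i * (corr (expMeanLogSU (n := n)) U₀ c)⁻¹)
        ≤ dist1 (loopHol U₀ c i) + dist1 ((corr (expMeanLogSU (n := n)) U₀ c)⁻¹) := GaugeGroup.dist1_mul_le _ _
      _ ≤ α + 2 * α := by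
          rw [GaugeGroup.dist1_inv]
          exact add_le_add (hα i) (dist1_corr_le_two_mul U₀ c hα hαδ hα6)
      _ = 3 * α := by ring
  rw [covLinAvgR0_covGrad_eq]
  -- the difference is the mean of the conjugation defects
  have e : Φ (emb c.src) - ((Fintype.card (Idx P) : ℂ))⁻¹ • ∑ i : Idx P, ((T i : Matrix.specialUnitaryGroup n ℂ) : Matrix n n ℂ) * Φ (emb c.tgt) *
          star ((T i : Matrix.specialUnitaryGroup n ℂ) : Matrix n n ℂ) -
        (Φ (emb c.src) - ((u : Matrix.specialUnitaryGroup n ℂ) : Matrix n n ℂ) * Φ (emb c.tgt) * star ((u : Matrix.specialUnitaryGroup n ℂ) : Matrix n n ℂ)) =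
      -(((Fintype.card (Idx P) : ℂ))⁻¹ • ∑ i : Idx P, (((T i : Matrix.specialUnitaryGroup n ℂ) : Matrix n n ℂ) * Φ (emb c.tgt) *
          star ((T i : Matrix.specialUnitaryGroup n ℂ) : Matrix n n ℂ) -
        ((u : Matrix.specialUnitaryGroup n ℂ) : Matrix n n ℂ) * Φ (emb c.tgt) * star ((u : Matrix.specialUnitaryGroup n ℂ) : Matrix n n ℂ))) := by
    have hI' : (Fintype.card (Idx P) : ℂ) ≠ 0 := by exact_mod_cast Fintype.card_ne_zero
    rw [Finset.sum_sub_distrib, Finset.sum_const, Finset.card_univ, smul_sub, ← Nat.cast_smul_eq_nsmul ℂ, smul_smul, inv_mul_cancel₀ hI', one_smul]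
    abel
  rw [e, norm_neg]
  calc ‖((Fintype.card (Idx P) : ℂ))⁻¹ • ∑ i : Idx P, (((T i : Matrix.specialUnitaryGroup n ℂ) : Matrix n n ℂ) * Φ (emb c.tgt) *
          star ((T i : Matrix.specialUnitaryGroup n ℂ) : Matrix n n ℂ) -
        ((u : Matrix.specialUnitaryGroup n ℂ) : Matrix n n ℂ) * Φ (emb c.tgt) * star ((u : Matrix.specialUnitaryGroup n ℂ) : Matrix n n ℂ))‖
      ≤ ((Fintype.card (Idx P) : ℝ))⁻¹ * ∑ i : Idx P, ‖((T i : Matrix.specialUnitaryGroup n ℂ) : Matrix n n ℂ) * Φ (emb c.tgt) *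
          star ((T i : Matrix.specialUnitaryGroup n ℂ) : Matrix n n ℂ) -
        ((u : Matrix.specialUnitaryGroup n ℂ) : Matrix n n ℂ) * Φ (emb c.tgt) * star ((u : Matrix.specialUnitaryGroup n ℂ) : Matrix n n ℂ)‖ := by
        rw [norm_smul, norm_inv, Complex.norm_natCast]
        exact mul_le_mul_of_nonneg_left (norm_sum_le _ _) (by positivity)
    _ ≤ ((Fintype.card (Idx P) : ℝ))⁻¹ * ∑ _i : Idx P, 6 * α * ‖Φ (emb c.tgt)‖ := by
        refine mul_le_mul_of_nonneg_left (Finset.sum_le_sum fun i _ => ?_) (by positivity)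
        rw [hTW i]
        calc _ ≤ 2 * ‖(((loopHol U₀ c i * (corr (expMeanLogSU (n := n)) U₀ c)⁻¹ : Matrix.specialUnitaryGroup n ℂ)) : Matrix n n ℂ) - 1‖ * ‖Φ (emb c.tgt)‖ :=
              norm_conj_mul_sub_conj_le _ _ _
          _ ≤ 2 * (3 * α) * ‖Φ (emb c.tgt)‖ := by gcongr; exact hdist i
          _ = 6 * α * ‖Φ (emb c.tgt)‖ := by ring
    _ = 6 * α * ‖Φ (emb c.tgt)‖ := by
        rw [Finset.sum_const, Finset.card_univ, nsmul_eq_mul]; field_simp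

end Gradient

end Summit.QuantumFields.YangMills.Theorems.FluctuationComparisonRegPrIntLS2BetaChartReadDerivStructure

end
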